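import Mathlib
import Summits.Ventures.PercRepro2.LocRows
import Summits.Ventures.PercRepro2.LocRows2
import Summits.Ventures.PercRepro2.LocSym

/-!
# The two-sided forbidden-set form of the monotone local injection: row (LOC0-mono-RB)
(blind cell PercRepro2, night-4 g2; census 2026-08-24T04:2xZ–05:xxZ, own code mining/night-4/g2/yrb.py,
kit j213261–j213264)

The second root `h` of (LOC0) enters only through `h ∉ H_l`.  Splitting its two roles — `h ∉ C_R(l)`
and `h ∉ C_B(l)` — between two vertex sets gives the statement a vertex-deletion induction has to
carry: a set `Y_R` the RED cluster of `l` must avoid and a set `Y_B` the BLUE cluster must avoid.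
Sources: `o ∈ B_side`, `C_R(l) ∩ Y_R = ∅`, `C_B(l) ∩ Y_B = ∅`.  Targets: `o ∈ R_side`, `C_B(l) ∩ Y_B = ∅`,
core `∩ Y_R = ∅`.  Relation: recolours only edges touching the source's blue cluster `B`, only adds
red inside `B`, blue cluster of the image inside `B`, no release, and NO ABSORPTION into `Y_R`
(`C_R(l)(image) ∖ B` avoids `Y_R`).  Census: `n = 5` ALL `(l, o, Y_R, Y_B)` with `|Y_R|, |Y_B| ≤ 2`
(8,438 cases) and `n = 6` (kit, ≥ 144,038 cases on 84 / 112 graphs at the time of writing): 0 Hall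
failures, for this relation and for the plain BL-local one.  `LocMonoTwo` is the statement;
`locU_of_locMonoTwo` recovers `(LOC-𝓤)` at the principal up-set when `Y_R = Y_B = {h}`.
Statements and the reduction only.
-/

namespace Summit.Ventures.PercRepro2

namespace LocRows

open Hull

variable {V : Type*} {E : Type*} [Fintype E] [DecidableEq E]

open scoped Classical

variable (ends : E → Sym2 V)

/-- Sources with two forbidden sets: `o ∈ B_side`, red cluster avoids `Y_R`, blue cluster avoids `Y_B`. -/
noncomputable def srcTwo (l o : V) (YR YB : Set V) : Finset (Config E) :=
  Finset.univ.filter fun ζ =>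
    o ∈ bside ends ζ l ∧ Disjoint (cluster ends ζ l) YR ∧ Disjoint (cluster ends (blue ζ) l) YB

/-- Targets with two forbidden sets: `o ∈ R_side`, blue cluster avoids `Y_B`, core avoids `Y_R`. -/
noncomputable def tgtTwo (l o : V) (YR YB : Set V) : Finset (Config E) :=
  Finset.univ.filter fun ζ =>
    o ∈ rside ends ζ l ∧ Disjoint (cluster ends (blue ζ) l) YB ∧ Disjoint (core ends ζ l) YR

/-- **Row (LOC0-mono-RB)**: the monotone, nested, no-release local injection `srcTwo → tgtTwo` with no
absorption into `Y_R`. -/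
def LocMonoTwo (l o : V) (YR YB : Set V) : Prop :=
  ∃ f : {ζ // ζ ∈ srcTwo ends l o YR YB} → Config E, Function.Injective f ∧
    ∀ x, f x ∈ tgtTwo ends l o YR YB ∧
      LocalAtSet ends (fun ζ => cluster ends (blue ζ) l) x.1 (f x) ∧
      (∀ e, e ∈ within ends (cluster ends (blue x.1) l) → x.1 e = true → f x e = true) ∧
      cluster ends (blue (f x)) l ⊆ cluster ends (blue x.1) l ∧
      cluster ends (blue x.1) l \ cluster ends (blue (f x)) l ⊆ cluster ends (f x) l ∧
      Disjoint (cluster ends (f x) l \ cluster ends (blue x.1) l) YR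

/-- At `Y_R = Y_B = {h}` the sources are the principal sources of (LOC0). -/
lemma srcTwo_singleton (l h o : V) :
    srcTwo ends l o {h} {h} = srcU ends l h {S : Set V | o ∈ S} := by
  ext ζ
  simp only [srcTwo, srcU, Finset.mem_filter, Finset.mem_univ, true_and,
    Set.disjoint_singleton_right, Set.mem_setOf_eq, hull, Set.mem_union, not_or]
  constructor
  · rintro ⟨ho, hR, hB⟩
    exact ⟨⟨hR, hB⟩, ho.1, ho.2⟩
  · rintro ⟨⟨hR, hB⟩, hoB, hoR⟩
    exact ⟨⟨hoB, hoR⟩, hR, hB⟩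

/-- (LOC0-mono-RB) at `Y_R = Y_B = {h}` gives (LOC-𝓤) at the principal up-set. -/
theorem locU_of_locMonoTwo (l h o : V) (hm : LocMonoTwo ends l o {h} {h}) :
    LocU ends l h {S : Set V | o ∈ S} := by
  obtain ⟨f, hf, hmem⟩ := hm
  have hmemsrc : ∀ ζ, ζ ∈ srcU ends l h {S : Set V | o ∈ S} → ζ ∈ srcTwo ends l o {h} {h} := by
    intro ζ hζ; rw [srcTwo_singleton]; exact hζ
  refine ⟨fun y => f ⟨y.1, hmemsrc y.1 y.2⟩, ?_, ?_⟩
  · intro y y' hyy'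
    have h1 := hf hyy'
    have h2 : y.1 = y'.1 := Subtype.mk_eq_mk.1 h1
    exact Subtype.ext h2
  · intro y
    obtain ⟨hx, hloc, _, _, _, habs⟩ := hmem ⟨y.1, hmemsrc y.1 y.2⟩
    refine ⟨?_, hloc⟩
    have hsrc := y.2
    simp only [srcU, Finset.mem_filter, Finset.mem_univ, true_and, Set.mem_setOf_eq] at hsrc
    simp only [tgtTwo, Finset.mem_filter, Finset.mem_univ, true_and,
      Set.disjoint_singleton_right] at hx
    obtain ⟨ho, hB, _⟩ := hx
    simp only [tgtU, Finset.mem_filter, Finset.mem_univ, true_and, Set.mem_setOf_eq, hull,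
      Set.mem_union, not_or]
    refine ⟨⟨?_, hB⟩, ho.1, ho.2⟩
    intro hR
    have hhB : h ∉ cluster ends (blue y.1) l := fun hh => hsrc.1 (Or.inr hh)
    exact (Set.disjoint_singleton_right.1 habs) ⟨hR, hhB⟩

/-- (LOC0-mono-RB) over all finite graphs, roots, targets and forbidden sets. -/
def LocMonoTwo_all : Prop :=
  ∀ (V E : Type) [Fintype V] [DecidableEq V] [Fintype E] [DecidableEq E] (ends : E → Sym2 V)
    (l o : V) (YR YB : Set V), l ≠ o → l ∉ YR → l ∉ YB → o ∉ YR → o ∉ YB → LocMonoTwo ends l o YR YB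

end LocRows

end Summit.Ventures.PercRepro2
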